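import Literature.NumberTheory.EllipticCurves.CanonicalPAdicHeightCycExistenceProofs
import Literature.NumberTheory.EllipticCurves.PadicSigmaSqTwoMazurTateExistenceHolds
import Literature.NumberTheory.EllipticCurves.PadicSigmaThreeExistence
import HarnessLib

/-!
# `WeierstrassCurve.exists_isCanonicalCyc` HOLDS — THE canonical cyclotomic `p`-adic height datum over
# every number field exists at every good ordinary prime (Mazur–Tate / Schneider / Mazur–Stein–Tate)

Topic `Literature/NumberTheory/EllipticCurves` (trunk T-NT-EC); PROOFS file (theorems only). DISCHARGE
of the named fact `WeierstrassCurve.exists_isCanonicalCyc` (`CanonicalPAdicHeightCyc.lean` §3): for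
every elliptic curve `E/ℚ` with globally minimal model `W`, every prime `p` of good ORDINARY reduction
and every number field `H` (any splitting behaviour of `p`; `W ⊗ H` globally minimal only makes the
predicate meaningful), there is a symmetric bilinear torsion-vanishing pairing on `E(H)`, invariant
under `Aut(H/ℚ)`, which on admissible points is the absolutely normalised cyclotomic `p`-adic height
`[H:ℚ]⁻¹ · (log_p N𝔡_H(x) − Σ_{w∣p} log_p N_{H_w/ℚ_p} Σ_p(z))` (`PAdicHeightDataK.IsCanonicalCyc`).

Two inputs, both tree theorems:

* `exists_isCanonicalCyc_of_pair` (`CanonicalPAdicHeightCycExistenceProofs.lean`): the datum exists at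
  ANY prime `p` once `W ⊗ ℚ_p` carries a Mazur–Tate sigma-squared pair (`IsMazurTateSigmaSqPair`);
* the sigma-squared pair EXISTS at every good ordinary prime (`exists_isMazurTateSigmaSqPair_of_goodOrdinary`):
  at `p = 2` by `exists_isMazurTateSigmaSqPair_two` with the discharged fact
  `mazurTate_sigmaSq_existsUnique_two_holds` (Mazur–Tate 1991 Thm. 3.1 at `2`, squared — Silverman 2005
  §5 Rem. 2 — proved in `PadicSigmaSqTwoMazurTateExistenceHolds.lean` by Blakestad–Grant's method); at
  odd `p` by `mazur_tate_sigma_exists_odd_holds` (`PadicSigmaThreeExistence.lean`: `p = 3` by the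
  Frobenius lift of `R̂₃`, `p ≥ 5` by `mazur_tate_sigma_existsUnique_holds`), squared
  (`IsMazurTateSigmaPair.sq`).

Result: **`WeierstrassCurve.exists_isCanonicalCyc_holds`**. No definitions, no named facts, no
`sorry`; standard axioms. BSD is not proved by any of this: the canonical height is one INPUT of the
`p`-adic Gross–Zagier / `p`-adic BSD statements of the cells that cite this fact.

## References

* B. Mazur, J. Tate, *The `p`-adic sigma function*, Duke Math. J. 62 (1991), Thm. 3.1. [MazurTate1991]
* B. Mazur, W. Stein, J. Tate, Doc. Math. Extra Vol. Coates (2006), Thm. 1.3, §2.6–2.8. [MazurSteinTate2006]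
* P. Schneider, *p-adic height pairings I*, Invent. Math. 69 (1982), §1. [Schneider1982]
* J. H. Silverman, Math. Ann. 332 (2005), §5 Thm. 11 and Rem. 2. [Silverman2005DivPoly]
* C. Blakestad, D. Grant, J. Number Theory 249 (2023), Thm. 1. [BlakestadGrant2023]
* D. Disegni, Compos. Math. 153 (2017), §1.3.1, §4.1.1 (4.1.7)–(4.1.8). [Disegni2017]
-/

noncomputable section

open scoped Classical
open WeierstrassCurve

namespace Literature.NumberTheory.EllipticCurves

/-- **The Mazur–Tate sigma-SQUARED pair of `W ⊗ ℚ_p` exists at every good ordinary prime `p`**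
(`p = 2`: Mazur–Tate 1991 Thm. 3.1 squared, Silverman 2005 §5 Rem. 2, tree theorem
`mazurTate_sigmaSq_existsUnique_two_holds`; odd `p`: the Mazur–Tate pair `(σ, c)` of
`mazur_tate_sigma_exists_odd_holds`, squared). [cite: MazurTate1991, Thm. 3.1]
[cite: Silverman2005DivPoly, §5 Thm. 11 and Rem. 2] [cite: MazurSteinTate2006, Thm. 1.3] -/
theorem exists_isMazurTateSigmaSqPair_of_goodOrdinary (W : WeierstrassCurve ℚ) [W.IsElliptic]
    [W.IsGloballyMinimal] (p : ℕ) [Fact p.Prime] (hgood : W.HasGoodReductionAtPrime p)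
    (hord : ¬ (p : ℤ) ∣ W.frobeniusTrace p) :
    ∃ Sq : PowerSeries ℚ_[p], ∃ c : ℚ_[p], (W.baseChange ℚ_[p]).IsMazurTateSigmaSqPair Sq c := by
  by_cases hp2 : p = 2
  · subst hp2
    exact W.exists_isMazurTateSigmaSqPair_two mazurTate_sigmaSq_existsUnique_two_holds hgood hord
  · obtain ⟨σ, c, h⟩ := mazur_tate_sigma_exists_odd_holds W p hp2 hgood hord
    exact ⟨σ ^ 2, c, h.sq⟩

end Literature.NumberTheory.EllipticCurves

open Literature.NumberTheory.EllipticCurves in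
/-- **`exists_isCanonicalCyc` HOLDS: existence (and `Aut(H/ℚ)`-invariance) of THE canonical cyclotomic
`p`-adic height over a number field.** For `E/ℚ` with globally minimal model `W`, a prime `p` of good
ORDINARY reduction (`p ∤ a_p`) and ANY number field `H`: there is `DH : PAdicHeightDataK W p H` with
`DH.IsCanonicalCyc` — on every admissible `P`, `[H:ℚ]·⟨P,P⟩ = log_p N𝔡(x) − Σ_{w∣p} log_p N_{H_w/ℚ_p} Σ_p(z)`
— invariant under `Aut(H/ℚ)` acting on `E(H)`; ANY `p`, `p = 2` and ramified `p` included. Proof: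
Mazur–Stein–Tate 2006 §2.6–2.8 on `Σ = σ²` with the `p`-part read at the embeddings `H → ℂ_p`
(`exists_isCanonicalCyc_of_pair`), fed with the Mazur–Tate sigma(-squared) pair, which exists at every
good ordinary prime (`exists_isMazurTateSigmaSqPair_of_goodOrdinary`).
[cite: MazurSteinTate2006, §2.7–2.8 (PDF p. 11 L7–58)] [cite: MazurTate1991, Thm. 3.1]
[cite: Schneider1982, §1] [cite: Disegni2017, §1.3.1 (arXiv v3 PDF p. 7 L30–38)] -/
theorem WeierstrassCurve.exists_isCanonicalCyc_holds : WeierstrassCurve.exists_isCanonicalCyc := by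
  intro W _ _ p _ H _ _ _ hgood hord
  exact exists_isCanonicalCyc_of_pair W p H (exists_isMazurTateSigmaSqPair_of_goodOrdinary W p hgood hord)

end
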